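import Literature.NumberTheory.LFunctions.DeuringZeroSpacingPhenomenon
import Literature.NumberTheory.LFunctions.DirichletLDerivativeLogSqBound
import Literature.Barriers.Parity.SiegelZeroDichotomy
import HarnessLib

/-!
# Even real characters: the regulator gains a logarithm — kernel repulsion
# `1 − β ≥ log(q/4)/(√q (log q)²)` and the quality cap `η ≤ 2√q` (PROVED only; debt 0)

Topic `Literature/NumberTheory/LFunctions`, namespace `Literature.NumberTheory.LFunctions.RealZeroRepulsion`
(continuing `RealZeroEffectiveRepulsionExplicit(II).lean`). Cell `parity-realchar` (SIEGEL INSTRUMENT),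
TARGET §2 row 16 — the EVEN column sharpened by a factor `≍ log q`.

For an EVEN primitive quadratic character `χ` mod `q` the field `K = ℚ(√q)` is REAL quadratic and the
class number formula reads `L(1,χ) = 2 h_K R_K/√q` with the regulator `R_K = log ε_q`. The tree already
uses the uniform floor `R_K ≥ log((1+√5)/2)` (`√q L(1,χ) ≥ 3/4`, `DeuringZeroSpacingPhenomenon.lean`);
here we use instead the growth of the fundamental unit: `ε_q = (G + B√q)/2` with integers `G, B ≥ 1`
(tree: `QuadIrr.exists_fundUnit_eq`), so `ε_q ≥ (1 + √q)/2 > √q/2` and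

  `R_K ≥ log((1 + √q)/2) ≥ ½ log(q/4)`,  hence  `√q · L(1, χ) ≥ 2 R_K h_K ≥ log(q/4)`.

Combined with the kernel's explicit upper half of Montgomery–Vaughan (11.10) (`‖L(1,χ)‖ ≤ (1−β) log²q`
at a real zero `β ≥ 1 − 1/(40 log q)`, `q ≥ 232`, `DirichletLDerivativeLogSqBound.lean`):

* `one_sub_realZero_ge_log_of_even` — **`1 − β ≥ log(q/4)/(√q (log q)²)` for every even primitive
  quadratic `χ` mod `q ≥ 1600` and every real zero `β`** (was `2/(3 √q log²q)` for both parities,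
  `RealZeroEffectiveRepulsionExplicitII.lean`: a gain `(3/2) log(q/4)`, e.g. `×19` at `q = 10⁶`, `×32`
  at `q = 10¹⁰`); the side condition `q ≥ 1600` only serves the far-zero case `β < 1 − 1/(40 log q)`.
* `one_sub_realZero_ge_log_of_even_of_ge_1e6` (appended) — the same with the kernel's `q ≥ 10⁶`
  derivative constant `0.46`: `1 − β ≥ (50/23) log(q/4)/(√q log²q)` (`≈ 27/(√q log²q)` at `10⁶`, `≈ 47`
  at `10¹⁰`; Bordignon's print: `100`).
* `isSiegelZero_quality_le_of_even` — a Siegel zero of quality `η` at an even character of conductor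
  `q ≥ 1600` has `η ≤ √q log q/log(q/4) ≤ 2√q`; `isSiegelZero_conductor_ge_of_even` — equivalently the
  conductor is at least `η²/4` (the both-parity kernel statement is `q ≥ η/3`).

Comparison with print: Bordignon, JNT 210 (2020) Thm 1.3 (even non-principal real `χ`, `q > 4·10⁵`):
`β₀ ≤ 1 − 100/(√q log²q)` — built from `|L′(σ,χ)| ≤ ⅛ log²q` (8× the kernel's derivative constant) and
the `L(1)`-floor `L(1,χ) ≥ 12.52/√q` (op. cit. Thm 1.2; by (5)–(7) there: `√q·L(1,χ) = h(√d) log η_d`, a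
computer-verified `h log η_d > 412` for `10⁷ < d`, `d·u₀² ≤ 7.5·10¹⁰`, and `log(u₀√d) ≥ ½ log(7.5·10¹⁰) ≥ 12.52`
beyond — a constant frozen at the computational boundary, which does not keep the `log q` growth;
docstring corrected 2026-08-27 on referee V183: the earlier gloss «`2 log(√q/2)` at `q = 4·10⁵`» was wrong,
that number is `11.51`). The kernel bound here beats `100/(√q log²q)` only for `log(q/4) > 100`; its point is the
SHAPE `1/(√q log q)` from `q = 1600` on with no table, no named fact.

## References

* [JacobsonWilliams2008] M. J. Jacobson, H. C. Williams, *Solving the Pell Equation*, §3.3 (the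
  fundamental unit `(G + B√D)/2`), as proved in the tree (`QuadIrr.exists_fundUnit_eq`).
* [NeukirchANT1999] Ch. VII §5 (5.11) (class number formula; tree `dedekindZeta_residue`, `r₁ = 2`).
* [MontgomeryVaughan2007] Theorem 11.4 (11.10) (explicit upper half, tree
  `DirichletAbel.norm_LFunction_one_le_log_sq_of_realZero`).
* M. Bordignon, J. Number Theory 210 (2020), Theorems 1.1–1.3 (print comparator; arXiv:1907.08327,
  quoted via [BenliGoelTwissZaman2025] Thm 2.8 in the tree).
* [TaoTeravainen2021] Definition 1.4 (`IsSiegelZero`).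
-/

noncomputable section

open Complex
open Module NumberField NumberField.InfinitePlace NumberField.Units
open Literature.Barriers.Parity
open Literature.NumberTheory.QuadraticFields Literature.NumberTheory.QuadraticFields.Quadratic

namespace Literature.NumberTheory.LFunctions

namespace RealZeroRepulsion

/-! ### The regulator of a real quadratic field grows like `½ log d_K` -/

section Regulator

variable {K : Type*} [Field K] [NumberField K]

/-- **`R_K ≥ log((1 + √d_K)/2)`** for a real quadratic field: `R_K = log ε_{d_K}` and
`ε_{d_K} = (G + B√d_K)/2` with `G, B ≥ 1`. [cite: JacobsonWilliams2008, §3.3 (ε = (G + B√D)/2)] -/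
theorem log_half_one_add_sqrt_le_regulator (h2 : finrank ℚ K = 2) (hd : 0 < NumberField.discr K) :
    Real.log ((1 + Real.sqrt (NumberField.discr K).toNat) / 2) ≤ regulator K := by
  rw [regulator_eq_log_fundUnit' h2 hd]
  set D : ℕ := (NumberField.discr K).toNat with hDdef
  obtain ⟨G, B, hG, hB, -, hε, -⟩ :=
    QuadIrr.exists_fundUnit_eq (not_isSquare_discr_toNat h2 hd) (discr_toNat_mod_four h2 hd)
  have hG' : (1 : ℝ) ≤ G := by exact_mod_cast hG
  have hB' : (1 : ℝ) ≤ B := by exact_mod_cast hB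
  have hs0 : 0 ≤ Real.sqrt D := Real.sqrt_nonneg _
  refine Real.log_le_log (by positivity) ?_
  rw [hε]
  have : (1 : ℝ) + Real.sqrt D ≤ G + B * Real.sqrt D := by nlinarith
  linarith

/-- **`R_K ≥ ½ log(d_K/4)`** (`(1 + √d)/2 ≥ √d/2 = √(d/4)`). [cite: JacobsonWilliams2008, §3.3 (ε = (G + B√D)/2)] -/
theorem half_log_le_regulator (h2 : finrank ℚ K = 2) (hd : 0 < NumberField.discr K) :
    (1 / 2) * Real.log ((NumberField.discr K).toNat / 4) ≤ regulator K := by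
  refine le_trans ?_ (log_half_one_add_sqrt_le_regulator h2 hd)
  set D : ℕ := (NumberField.discr K).toNat with hDdef
  have hD5 : 5 ≤ D := five_le_discr_toNat h2 hd
  have hD0 : (0 : ℝ) < D := by exact_mod_cast (show 0 < D by omega)
  have hs0 : 0 < Real.sqrt D := Real.sqrt_pos.mpr hD0
  -- `½ log(D/4) = log √(D/4) = log(√D/2) ≤ log((1+√D)/2)`
  have h1 : (1 / 2) * Real.log ((D : ℝ) / 4) = Real.log (Real.sqrt D / 2) := by
    rw [Real.log_div hs0.ne' (by norm_num), Real.log_sqrt hD0.le, Real.log_div hD0.ne' (by norm_num)]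
    have : Real.log (4 : ℝ) = 2 * Real.log 2 := by
      rw [show (4 : ℝ) = 2 ^ 2 by norm_num, Real.log_pow]; push_cast; ring
    rw [this]; ring
  rw [h1]
  exact Real.log_le_log (by positivity) (by linarith)

/-- **`κ_K ≥ log(d_K/4)/√d_K` for a real quadratic field** (`κ_K = 2 R_K h_K/√d_K`, `h_K ≥ 1`,
`R_K ≥ ½ log(d_K/4)`). [cite: NeukirchANT1999, Ch. VII §5 (5.11)] -/
theorem dedekindZeta_residue_ge_log_of_discr_pos (h2 : finrank ℚ K = 2) (hd : 0 < NumberField.discr K) :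
    Real.log ((NumberField.discr K).toNat / 4) / Real.sqrt |(NumberField.discr K : ℝ)| ≤
      dedekindZeta_residue K := by
  obtain ⟨hr₁, hr₂⟩ := nrRealPlaces_eq_two_and_nrComplexPlaces_eq_zero h2 hd
  have hw := torsionOrder_eq_two_of_discr_pos h2 hd
  have hR := half_log_le_regulator h2 hd
  have hR0 : 0 < regulator K := regulator_pos K
  have hh : (1 : ℝ) ≤ classNumber K := by exact_mod_cast classNumber_pos K
  have hdR : 0 < Real.sqrt |(NumberField.discr K : ℝ)| :=
    Real.sqrt_pos.2 (abs_pos.2 (by exact_mod_cast NumberField.discr_ne_zero K))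
  rw [NumberField.dedekindZeta_residue_def, hr₁, hr₂, hw]
  rw [div_le_div_iff₀ hdR (by positivity)]
  push_cast
  have : regulator K * 1 ≤ regulator K * (classNumber K : ℝ) :=
    mul_le_mul_of_nonneg_left hh hR0.le
  nlinarith

end Regulator

/-! ### The `L(1)`-floor for even characters with the logarithm -/

/-- **`√D · L(1, χ) ≥ log(D/4)` for every EVEN real primitive character `χ` mod `D > 1`.** Bridge as in
`sqrt_mul_norm_LFunction_one_ge_of_even`: `χ` is the Kronecker character of the real quadratic field `K`
with `d_K = D` (`D` a positive fundamental discriminant), `L(1,χ) = κ_K`, and `κ_K ≥ log(D/4)/√D`.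
[cite: NeukirchANT1999, Ch. VII §5 (5.11)] [cite: JacobsonWilliams2008, §3.3 (ε = (G + B√D)/2)] -/
theorem sqrt_mul_norm_LFunction_one_ge_log_of_even {D : ℕ} [NeZero D] (hD : 1 < D)
    {χ : DirichletCharacter ℂ D} (hprim : χ.IsPrimitive) (hquad : χ.IsQuadratic) (heven : χ.Even) :
    Real.log ((D : ℝ) / 4) ≤ Real.sqrt D * ‖χ.LFunction 1‖ := by
  classical
  obtain ⟨K, instF, instNF, h2, hdK⟩ := exists_numberField_discr_eq
    (PrimitiveQuadratic.isFundamentalDiscriminant_of_even hprim hquad heven hD)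
  have hD0 : 0 < D := by omega
  have hd : 0 < NumberField.discr K := by rw [hdK]; exact_mod_cast hD0
  -- `χ ≠ 1` (primitive of conductor `D > 1`)
  have hχ1 : χ ≠ 1 := by
    intro h1
    rw [DirichletCharacter.isPrimitive_def, h1, DirichletCharacter.conductor_one] at hprim
    omega
  -- `ζ_K = ζ · L(χ)` on `Re s > 1`
  have hζ : ∀ s : ℝ, 1 < s →
      NumberField.dedekindZeta K s = riemannZeta s * LSeries (fun n => χ n) s := by
    intro s hs
    refine dedekindZeta_eq_riemannZeta_mul_LSeries_of_kronecker h2 χ ?_ ?_ (by simpa using hs)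
    · intro p hp hp2
      haveI := Fact.mk hp
      rw [hdK, PrimitiveQuadratic.apply_prime_eq_legendreSym_of_even hprim hquad heven p hp2,
        jacobiSym.legendreSym.to_jacobiSym]
    · rw [hdK]
      rcases Nat.even_or_odd D with hev | hod
      · have h8a : (D : ℤ) % 8 ≠ 1 := by obtain ⟨k, hk⟩ := hev; omega
        have h8b : (D : ℤ) % 8 ≠ 5 := by obtain ⟨k, hk⟩ := hev; omega
        rw [if_neg h8a, if_neg h8b, PrimitiveQuadratic.apply_two_of_even hev χ]
      · have hsq := PrimitiveQuadratic.squarefree_of_isPrimitive_of_isQuadratic hod hprim hquad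
        have h4 : (D : ℤ) % 4 = 1 := by
          have := PrimitiveQuadratic.mod_four_eq_one_of_even hod hD hprim hquad heven
          omega
        have hval : χ (2 : ZMod D) = (jacobiSym 2 D : ℂ) := by
          have := PrimitiveQuadratic.apply_natCast_eq_jacobiSym hod hsq χ hprim hquad 2
          rw [Nat.cast_ofNat] at this
          rw [this]; norm_cast
        by_cases h1 : (D : ℤ) % 8 = 1
        · have hJ : jacobiSym 2 D = 1 := by
            have := (jacobiSym_two_natAbs_eq_one_iff h4).mpr h1
            rwa [Int.natAbs_natCast] at this
          rw [if_pos h1, hval, hJ, Int.cast_one]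
        · have h5 : (D : ℤ) % 8 = 5 := by omega
          have hJ : jacobiSym 2 D = -1 := by
            have := (jacobiSym_two_natAbs_eq_neg_one_iff h4).mpr h5
            rwa [Int.natAbs_natCast] at this
          rw [if_neg h1, if_pos h5, hval, hJ, Int.cast_neg, Int.cast_one]
  -- class number formula with the logarithmic regulator bound
  have hL := LFunction_one_eq_dedekindZeta_residue_of_eq hχ1 hζ
  have hres := dedekindZeta_residue_ge_log_of_discr_pos h2 hd
  have habs : |(NumberField.discr K : ℝ)| = (D : ℝ) := by
    rw [hdK]; push_cast; exact abs_of_nonneg (Nat.cast_nonneg D)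
  have htoNat : ((NumberField.discr K).toNat : ℝ) = D := by
    rw [hdK]; simp
  rw [habs, htoNat] at hres
  have hsqrt : 0 < Real.sqrt D := Real.sqrt_pos.mpr (by exact_mod_cast hD0)
  have hres_ge := dedekindZeta_residue_ge_of_discr_pos h2 hd
  have hlogφ := three_eighths_le_log_goldenRatio
  have hres0 : 0 ≤ NumberField.dedekindZeta_residue K :=
    le_trans (div_nonneg (by linarith) (Real.sqrt_nonneg _)) hres_ge
  have hval : ‖χ.LFunction 1‖ = NumberField.dedekindZeta_residue K := by
    rw [hL, Complex.norm_real, Real.norm_eq_abs, abs_of_nonneg hres0]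
  rw [hval]
  have := mul_le_mul_of_nonneg_left hres hsqrt.le
  rwa [mul_div_cancel₀ _ hsqrt.ne'] at this

/-! ### Repulsion and quality for even characters -/

/-- `log q > 7` for `q ≥ 1600` (`e⁷ < 1097`). [folklore] -/
private theorem seven_lt_log {q : ℕ} (hq : 1600 ≤ q) : 7 < Real.log q := by
  have hq' : (1600 : ℝ) ≤ q := by exact_mod_cast hq
  rw [Real.lt_log_iff_exp_lt (by linarith)]
  have h1 : Real.exp (1 : ℝ) < 2.7182818286 := Real.exp_one_lt_d9
  have h7 : Real.exp (7 : ℝ) = Real.exp 1 ^ 7 := by rw [Real.exp_one_pow]; norm_num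
  rw [h7]
  have h0 : 0 < Real.exp (1 : ℝ) := Real.exp_pos 1
  nlinarith [pow_le_pow_left₀ h0.le h1.le 7]

/-- **Kernel repulsion for EVEN characters with the logarithm: `1 − β ≥ log(q/4)/(√q (log q)²)`** for
every even primitive quadratic `χ` mod `q ≥ 1600` and every real zero `β` of `L(s, χ)`. Near zeros
(`β ≥ 1 − 1/(40 log q)`): `log(q/4)/√q ≤ ‖L(1,χ)‖ ≤ (1 − β) log²q`; far zeros: `1 − β > 1/(40 log q)
≥ log(q/4)/(√q log²q)` because `√q ≥ 40`. [cite: MontgomeryVaughan2007, Theorem 11.4 (11.10)]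
[cite: NeukirchANT1999, Ch. VII §5 (5.11)] -/
theorem one_sub_realZero_ge_log_of_even {q : ℕ} [NeZero q] (hq : 1600 ≤ q)
    {χ : DirichletCharacter ℂ q} (hprim : χ.IsPrimitive) (hquad : χ.IsQuadratic) (heven : χ.Even)
    {β : ℝ} (hzero : χ.LFunction β = 0) :
    Real.log ((q : ℝ) / 4) / (Real.sqrt q * Real.log q ^ 2) ≤ 1 - β := by
  have hq' : (1600 : ℝ) ≤ q := by exact_mod_cast hq
  have hq0 : (0 : ℝ) < q := by linarith
  have hL7 := seven_lt_log hq
  have hL0 : 0 < Real.log q := by linarith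
  have hsq40 : 40 ≤ Real.sqrt q := by
    rw [show (40 : ℝ) = Real.sqrt (40 ^ 2) by rw [Real.sqrt_sq (by norm_num)]]
    exact Real.sqrt_le_sqrt (by norm_num; linarith)
  have hsq : 0 < Real.sqrt q := by linarith
  have hden : 0 < Real.sqrt q * Real.log q ^ 2 := by positivity
  have hlog4 : Real.log ((q : ℝ) / 4) ≤ Real.log q :=
    Real.log_le_log (by positivity) (by linarith)
  have hlog4pos : 0 < Real.log ((q : ℝ) / 4) := Real.log_pos (by linarith)
  set r : ℝ := 1 / (40 * Real.log q) with hrdef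
  by_cases hfar : β < 1 - r
  · -- far zero
    have h1 : Real.log ((q : ℝ) / 4) / (Real.sqrt q * Real.log q ^ 2) ≤ r := by
      rw [hrdef, div_le_div_iff₀ hden (by positivity)]
      -- `40 log(q/4) log q ≤ √q log² q`
      have : 40 * Real.log ((q : ℝ) / 4) ≤ Real.sqrt q * Real.log q := by
        calc 40 * Real.log ((q : ℝ) / 4) ≤ 40 * Real.log q := by nlinarith
          _ ≤ Real.sqrt q * Real.log q := by nlinarith
      nlinarith
    linarith
  · rw [not_lt] at hfar
    have hup := DirichletAbel.norm_LFunction_one_le_log_sq_of_realZero (by omega) hprim hfar hzero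
    have hfloor := sqrt_mul_norm_LFunction_one_ge_log_of_even (by omega) hprim hquad heven
    -- `log(q/4) ≤ √q ‖L(1)‖ ≤ √q (1−β) log² q`
    have key : Real.log ((q : ℝ) / 4) ≤ Real.sqrt q * ((1 - β) * Real.log q ^ 2) :=
      hfloor.trans (mul_le_mul_of_nonneg_left hup hsq.le)
    rw [div_le_iff₀ hden]
    nlinarith

/-- **Quality cap for even characters: `η ≤ √q log q/log(q/4)`** for a Tao–Teräväinen Siegel zero of
quality `η` attached to an EVEN primitive quadratic character of conductor `q ≥ 1600` (both-parity kernel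
cap: `(3/2)√q log q`). [cite: TaoTeravainen2021, Definition 1.4] [cite: NeukirchANT1999, Ch. VII §5 (5.11)] -/
theorem isSiegelZero_quality_le_of_even {q : ℕ} [NeZero q] (hq : 1600 ≤ q)
    {χ : DirichletCharacter ℂ q} (heven : χ.Even) {η : ℝ} (hS : IsSiegelZero χ η) :
    η ≤ Real.sqrt q * Real.log q / Real.log ((q : ℝ) / 4) := by
  obtain ⟨hprim, hquad, h10, hzero⟩ := hS
  have hq' : (1600 : ℝ) ≤ q := by exact_mod_cast hq
  have hL7 := seven_lt_log hq
  have hL0 : 0 < Real.log q := by linarith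
  have hη : 0 < η := by linarith
  have hlog4pos : 0 < Real.log ((q : ℝ) / 4) := Real.log_pos (by linarith)
  have hsq : 0 < Real.sqrt q := Real.sqrt_pos.mpr (by linarith)
  have h := one_sub_realZero_ge_log_of_even hq hprim hquad heven hzero
  -- `1 − β = 1/(η log q)`
  have hβ : 1 - (1 - 1 / (η * Real.log q)) = 1 / (η * Real.log q) := by ring
  rw [hβ] at h
  rw [div_le_div_iff₀ (by positivity) (by positivity)] at h
  rw [le_div_iff₀ hlog4pos]
  -- h : log(q/4) · (η log q) ≤ 1 · (√q log² q)
  nlinarith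

/-- **`η ≤ 2√q` and the conductor floor `q ≥ η²/4` for even characters** (`log q/log(q/4) ≤ 2` iff
`q ≥ 16`). [cite: TaoTeravainen2021, Definition 1.4] [cite: NeukirchANT1999, Ch. VII §5 (5.11)] -/
theorem isSiegelZero_conductor_ge_of_even {q : ℕ} [NeZero q] (hq : 1600 ≤ q)
    {χ : DirichletCharacter ℂ q} (heven : χ.Even) {η : ℝ} (hS : IsSiegelZero χ η) :
    η ≤ 2 * Real.sqrt q ∧ η ^ 2 / 4 ≤ q := by
  have h := isSiegelZero_quality_le_of_even hq heven hS
  have hq' : (1600 : ℝ) ≤ q := by exact_mod_cast hq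
  have hq0 : (0 : ℝ) < q := by linarith
  have hL0 : 0 < Real.log q := by linarith [seven_lt_log hq]
  have hsq : 0 < Real.sqrt q := Real.sqrt_pos.mpr hq0
  have hη : 0 < η := by linarith [hS.ten_le]
  -- `log q ≤ 2 log(q/4)` since `q ≥ 16`
  have hlog4 : Real.log ((q : ℝ) / 4) = Real.log q - Real.log 4 :=
    Real.log_div hq0.ne' (by norm_num)
  have hlog4val : Real.log (4 : ℝ) < 1.3863 := by
    have := Real.log_two_lt_d9
    rw [show (4 : ℝ) = 2 ^ 2 by norm_num, Real.log_pow]; push_cast; linarith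
  have hlog4pos : 0 < Real.log ((q : ℝ) / 4) := by rw [hlog4]; linarith [seven_lt_log hq]
  have h2 : Real.log q ≤ 2 * Real.log ((q : ℝ) / 4) := by rw [hlog4]; linarith [seven_lt_log hq]
  have hη2 : η ≤ 2 * Real.sqrt q := by
    refine h.trans ?_
    rw [div_le_iff₀ hlog4pos]
    nlinarith
  refine ⟨hη2, ?_⟩
  have hsqq : Real.sqrt q ^ 2 = q := Real.sq_sqrt hq0.le
  nlinarith [hη2, hη]


/-! ### Appended 2026-08-27: the `q ≥ 10⁶` constant (`‖L′‖ ≤ 0.46 log²q`) -/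

/-- **Even characters, `q ≥ 10⁶`: `1 − β ≥ (50/23)·log(q/4)/(√q (log q)²)`** (the kernel's derivative
constant `23/50 = 0.46` on `[1 − 1/(40 log q), 1]` for `q ≥ 10⁶`, `DirichletAbel.norm_deriv_LFunction_le_log_sq_of_ge_1e6`,
in place of `1`). At `q = 10⁶` this is `≈ 27/(√q log²q)`, at `q = 10¹⁰` `≈ 47/(√q log²q)` — against
Bordignon's printed even constant `100`. [cite: MontgomeryVaughan2007, Theorem 11.4 (11.10)]
[cite: NeukirchANT1999, Ch. VII §5 (5.11)] -/
theorem one_sub_realZero_ge_log_of_even_of_ge_1e6 {q : ℕ} [NeZero q] (hq : 10 ^ 6 ≤ q)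
    {χ : DirichletCharacter ℂ q} (hprim : χ.IsPrimitive) (hquad : χ.IsQuadratic) (heven : χ.Even)
    {β : ℝ} (hzero : χ.LFunction β = 0) :
    50 / 23 * Real.log ((q : ℝ) / 4) / (Real.sqrt q * Real.log q ^ 2) ≤ 1 - β := by
  have hq1600 : 1600 ≤ q := le_trans (by norm_num) hq
  have hq' : (10 : ℝ) ^ 6 ≤ q := by exact_mod_cast hq
  have hq0 : (0 : ℝ) < q := by linarith
  have hne : χ ≠ 1 := by
    rintro rfl
    rw [DirichletCharacter.isPrimitive_def, DirichletCharacter.conductor_one] at hprim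
    omega
  have hβ1 : β < 1 := by
    by_contra hcon
    exact DirichletCharacter.LFunction_ne_zero_of_one_le_re χ (Or.inl hne) (s := β)
      (by simp; linarith) hzero
  have hL7 := seven_lt_log hq1600
  have hL0 : 0 < Real.log q := by linarith
  have hsq1000 : 1000 ≤ Real.sqrt q := by
    rw [show (1000 : ℝ) = Real.sqrt (1000 ^ 2) by rw [Real.sqrt_sq (by norm_num)]]
    exact Real.sqrt_le_sqrt (by norm_num at hq' ⊢; linarith)
  have hsq : 0 < Real.sqrt q := by linarith
  have hden : 0 < Real.sqrt q * Real.log q ^ 2 := by positivity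
  have hlog4 : Real.log ((q : ℝ) / 4) ≤ Real.log q :=
    Real.log_le_log (by positivity) (by linarith)
  have hlog4pos : 0 < Real.log ((q : ℝ) / 4) := Real.log_pos (by linarith)
  set r : ℝ := 1 / (40 * Real.log q) with hrdef
  by_cases hfar : β < 1 - r
  · -- far zero: `(50/23)·40·log(q/4)·log q ≤ √q log² q` since `√q ≥ 1000 ≥ 2000/23`
    have h1 : 50 / 23 * Real.log ((q : ℝ) / 4) / (Real.sqrt q * Real.log q ^ 2) ≤ r := by
      rw [hrdef, div_le_div_iff₀ hden (by positivity)]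
      have : 50 / 23 * Real.log ((q : ℝ) / 4) * 40 ≤ Real.sqrt q * Real.log q := by
        nlinarith
      nlinarith
    linarith
  · rw [not_lt] at hfar
    have h := DirichletAbel.norm_LFunction_one_sub_le_of_norm_deriv_le χ hne hβ1.le fun σ h1 h2 =>
      DirichletAbel.norm_deriv_LFunction_le_log_sq_of_ge_1e6 hq hprim (le_trans hfar h1) h2
    rw [hzero, sub_zero] at h
    have hfloor := sqrt_mul_norm_LFunction_one_ge_log_of_even (by omega) hprim hquad heven
    -- `log(q/4) ≤ √q ‖L(1)‖ ≤ √q · (23/50) log²q (1−β)`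
    have key : Real.log ((q : ℝ) / 4) ≤ Real.sqrt q * (23 / 50 * Real.log q ^ 2 * (1 - β)) :=
      hfloor.trans (mul_le_mul_of_nonneg_left h hsq.le)
    rw [div_le_iff₀ hden]
    nlinarith

end RealZeroRepulsion

/-! ### Appended 2026-08-27: Watkins' Deuring-spacing hypothesis is void for EVEN characters up to
`D ≤ e^{1296}` (was `e^{625}` with the `3/4`-floor) -/

namespace Watkins2021

/-- **No EVEN real primitive character of conductor `12 ≤ D ≤ e^{1296}` is exceptional in Watkins'
sense** (`H(χ) = √D·L(1,χ) ≤ D^{1/6} e^{−(log D)^{3/4}}`): with the logarithmic floor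
`H(χ) ≥ log(D/4) ≥ log 3 > 1` (`RealZeroRepulsion.sqrt_mul_norm_LFunction_one_ge_log_of_even`) and
`D^{1/6} e^{−(log D)^{3/4}} = e^{L/6 − L^{3/4}} ≤ 1` for `L = log D ≤ 1296 = 6⁴` (`L/6 ≤ L^{3/4}` iff
`L^{1/4} ≤ 6`). The tree's `not_isExceptional_of_even` (floor `3/4`) reached `e^{625}`.
[cite: Watkins2021DeuringZeroSpacing, Theorem 1.1] [cite: NeukirchANT1999, Ch. VII §5 (5.11)] -/
theorem not_isExceptional_of_even_log {D : ℕ} [NeZero D] (hD : 12 ≤ D) (hDle : Real.log D ≤ 1296)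
    {χ : DirichletCharacter ℂ D} (hprim : χ.IsPrimitive) (hquad : χ.IsQuadratic) (heven : χ.Even) :
    ¬ IsExceptional χ := by
  intro hexc
  unfold IsExceptional H at hexc
  have hfloor := RealZeroRepulsion.sqrt_mul_norm_LFunction_one_ge_log_of_even (by omega) hprim hquad heven
  have hD12 : (12 : ℝ) ≤ D := by exact_mod_cast hD
  have hDpos : (0 : ℝ) < D := by linarith
  set L : ℝ := Real.log D with hLdef
  have hL0 : 0 < L := Real.log_pos (by linarith)
  -- `D^{1/6} e^{−L^{3/4}} = e^{L/6 − L^{3/4}} ≤ e^0 = 1`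
  have hthr : (D : ℝ) ^ (1 / 6 : ℝ) * Real.exp (-(Real.log D ^ (3 / 4 : ℝ))) =
      Real.exp (L / 6 - L ^ (3 / 4 : ℝ)) := by
    rw [Real.rpow_def_of_pos hDpos, ← Real.exp_add]
    congr 1
    rw [hLdef]; ring
  have hexp_le : L / 6 - L ^ (3 / 4 : ℝ) ≤ 0 := by
    -- `L = L^{1/4} · L^{3/4}` and `L^{1/4} ≤ 1296^{1/4} = 6`
    have h14 : L ^ (1 / 4 : ℝ) ≤ 6 := by
      have h1 : L ^ (1 / 4 : ℝ) ≤ (1296 : ℝ) ^ (1 / 4 : ℝ) := Real.rpow_le_rpow hL0.le hDle (by norm_num)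
      have h2 : (1296 : ℝ) ^ (1 / 4 : ℝ) = 6 := by
        rw [show (1296 : ℝ) = 6 ^ (4 : ℝ) by norm_num, ← Real.rpow_mul (by norm_num)]
        norm_num
      linarith
    have hsplit : L = L ^ (1 / 4 : ℝ) * L ^ (3 / 4 : ℝ) := by
      rw [← Real.rpow_add hL0]; norm_num
    have h34 : 0 ≤ L ^ (3 / 4 : ℝ) := (Real.rpow_pos_of_pos hL0 _).le
    have hmul : L ^ (1 / 4 : ℝ) * L ^ (3 / 4 : ℝ) ≤ 6 * L ^ (3 / 4 : ℝ) :=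
      mul_le_mul_of_nonneg_right h14 h34
    rw [← hsplit] at hmul
    linarith
  rw [hthr] at hexc
  have hexp1 : Real.exp (L / 6 - L ^ (3 / 4 : ℝ)) ≤ 1 := by
    calc Real.exp (L / 6 - L ^ (3 / 4 : ℝ)) ≤ Real.exp 0 := Real.exp_le_exp.mpr hexp_le
      _ = 1 := Real.exp_zero
  -- `log(D/4) ≥ log 3 > 1`
  have hlog3 : 1 < Real.log ((D : ℝ) / 4) := by
    have h3 : (3 : ℝ) ≤ (D : ℝ) / 4 := by linarith
    have : 1 < Real.log 3 := by
      rw [Real.lt_log_iff_exp_lt (by norm_num)]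
      have := Real.exp_one_lt_d9; linarith
    exact lt_of_lt_of_le this (Real.log_le_log (by norm_num) h3)
  linarith

/-- Both parities: **no real primitive character of conductor `12 ≤ D ≤ e^{625}`… — and for EVEN
characters none up to `e^{1296}` — is Watkins-exceptional**; combined statement on the common range is the
tree's `not_isExceptional`; this records the even extension. [cite: Watkins2021DeuringZeroSpacing, Theorem 1.1] -/
theorem not_isExceptional_of_even_log' {D : ℕ} [NeZero D] (hD : 12 ≤ D) (hDle : (D : ℝ) ≤ Real.exp 1296)
    {χ : DirichletCharacter ℂ D} (hprim : χ.IsPrimitive) (hquad : χ.IsQuadratic) (heven : χ.Even) :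
    ¬ IsExceptional χ := by
  have hD12 : (12 : ℝ) ≤ D := by exact_mod_cast hD
  have hDpos : (0 : ℝ) < D := by linarith
  exact not_isExceptional_of_even_log hD ((Real.log_le_iff_le_exp hDpos).mpr hDle) hprim hquad heven

end Watkins2021

/-! ### Appended 2026-08-28: the sharp unit floor `ε_d ≥ (√(d−4) + √d)/2` — `R_K ≥ ½ log(d_K − 4)` and
`√D · L(1, χ) ≥ log(D − 4)` for even characters (twice the printed `log((√(d+4)+√d)/2)`)

The fundamental unit of the real quadratic field of discriminant `d` is `ε_d = (G + B√d)/2` with integers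
`G, B ≥ 1` and `G² − dB² = ±4` (`QuadIrr.exists_fundUnit_eq`, [cite: JacobsonWilliams2008, §3.3]); the norm
equation gives `G² ≥ dB² − 4 ≥ d − 4`, so `ε_d ≥ (√(d−4) + √d)/2 ≥ √(d−4)` and `R_K = log ε_d ≥ ½ log(d−4)`
(against `½ log(d/4)` from `G ≥ 1` alone, above). With the class number formula `L(1,χ_d) = 2 h_K R_K/√d`,
`h_K ≥ 1`: **`√d · L(1, χ_d) ≥ log(d − 4)`**. PRINT COMPARISON (recorded, not smoothed over):
Bennett–Martin–O'Bryant–Rechnitzer (Illinois J. Math. 62 (2018), proof of Lemma 6.3) and Bordignon (J. Number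
Theory 210 (2020), (5)–(7)) write the same formula as `L(1,χ_d) = h(√d) log η_d/√d` with `η_d = (v₀+u₀√d)/2`,
`v₀² − du₀² = 4`, and bound `h(√d) log η_d ≥ log η_d ≥ log((√(d+4)+√d)/2) ≈ ½ log d`; in that normal form
`h(√d)` is the NARROW class number and `η_d ∈ {ε_d, ε_d²}` according as `N(ε_d) = +1` (then `h(√d) = 2h_K`)
or `−1`, so `h(√d) log η_d = 2 h_K R_K ≥ 2 log ε_d` in both cases — the factor `2` their bound drops, which is
why they verify `h(√d) log η_d > 12` on `4·10⁵ ≤ d < 2.65·10¹⁰` (BMOR §7.10) resp. `> 12.52` up to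
`d u₀² ≤ 7.5·10¹⁰` (Bordignon, 1800 CPU-hours) by computer; `log(d − 4) ≥ 12.899` for `d > 4·10⁵` makes both
computations unnecessary for their stated consequences (`bordignon2020_theorem12`, BMOR Lemma 6.3 — see
`ExplicitExceptionalZeroBoundsRealCharacters.lean`). -/

namespace RealZeroRepulsion

section RegulatorSharp

variable {K : Type*} [Field K] [NumberField K]

/-- **`R_K ≥ log((√(d_K − 4) + √d_K)/2)`** for a real quadratic field: `ε = (G + B√d)/2`, `B ≥ 1`,
`G² = dB² ± 4 ≥ d − 4`. [cite: JacobsonWilliams2008, §3.3 (ε = (G + B√D)/2 with (3.18))] -/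
theorem log_half_sqrt_sub_four_add_sqrt_le_regulator (h2 : finrank ℚ K = 2) (hd : 0 < NumberField.discr K) :
    Real.log ((Real.sqrt (((NumberField.discr K).toNat : ℝ) - 4) + Real.sqrt (NumberField.discr K).toNat) / 2)
      ≤ regulator K := by
  rw [regulator_eq_log_fundUnit' h2 hd]
  set D : ℕ := (NumberField.discr K).toNat with hDdef
  obtain ⟨G, B, hG, hB, hnorm, hε, -⟩ :=
    QuadIrr.exists_fundUnit_eq (not_isSquare_discr_toNat h2 hd) (discr_toNat_mod_four h2 hd)
  have hD5 : 5 ≤ D := five_le_discr_toNat h2 hd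
  have hD5' : (5 : ℝ) ≤ D := by exact_mod_cast hD5
  have hG' : (1 : ℝ) ≤ G := by exact_mod_cast hG
  have hB' : (1 : ℝ) ≤ B := by exact_mod_cast hB
  have hs0 : 0 ≤ Real.sqrt D := Real.sqrt_nonneg _
  have hs4 : 0 < Real.sqrt ((D : ℝ) - 4) := Real.sqrt_pos.mpr (by linarith)
  -- the norm equation: `G² ≥ D B² − 4 ≥ D − 4`
  have hGsq : (D : ℝ) - 4 ≤ (G : ℝ) ^ 2 := by
    have hB2 : (1 : ℝ) ≤ (B : ℝ) ^ 2 := by nlinarith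
    have hD0 : (0 : ℝ) ≤ D := by linarith
    rcases hnorm with h | h
    · have h' : ((G : ℝ)) ^ 2 - D * (B : ℝ) ^ 2 = 4 := by exact_mod_cast h
      nlinarith
    · have h' : ((G : ℝ)) ^ 2 - D * (B : ℝ) ^ 2 = -4 := by exact_mod_cast h
      nlinarith
  have hGge : Real.sqrt ((D : ℝ) - 4) ≤ G := by
    rw [Real.sqrt_le_left]  <;> first | exact hGsq | linarith
  refine Real.log_le_log (by positivity) ?_
  rw [hε]
  have : Real.sqrt ((D : ℝ) - 4) + Real.sqrt D ≤ G + B * Real.sqrt D := by nlinarith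
  linarith

/-- **`R_K ≥ ½ log(d_K − 4)`** (`√(d−4) ≤ (√(d−4) + √d)/2`). [cite: JacobsonWilliams2008, §3.3 (ε = (G + B√D)/2 with (3.18))] -/
theorem half_log_sub_four_le_regulator (h2 : finrank ℚ K = 2) (hd : 0 < NumberField.discr K) :
    (1 / 2) * Real.log (((NumberField.discr K).toNat : ℝ) - 4) ≤ regulator K := by
  refine le_trans ?_ (log_half_sqrt_sub_four_add_sqrt_le_regulator h2 hd)
  set D : ℕ := (NumberField.discr K).toNat with hDdef
  have hD5 : 5 ≤ D := five_le_discr_toNat h2 hd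
  have hD5' : (5 : ℝ) ≤ D := by exact_mod_cast hD5
  have h4 : (0 : ℝ) < (D : ℝ) - 4 := by linarith
  have hs4 : 0 < Real.sqrt ((D : ℝ) - 4) := Real.sqrt_pos.mpr h4
  have hmono : Real.sqrt ((D : ℝ) - 4) ≤ Real.sqrt D := Real.sqrt_le_sqrt (by linarith)
  have h1 : (1 / 2) * Real.log ((D : ℝ) - 4) = Real.log (Real.sqrt ((D : ℝ) - 4)) := by
    rw [Real.log_sqrt h4.le]; ring
  rw [h1]
  exact Real.log_le_log hs4 (by linarith)

/-- **`κ_K ≥ log(d_K − 4)/√d_K` for a real quadratic field** (`κ_K = 2 R_K h_K/√d_K`, `h_K ≥ 1`,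
`R_K ≥ ½ log(d_K − 4)`). [cite: NeukirchANT1999, Ch. VII §5 (5.11)] -/
theorem dedekindZeta_residue_ge_log_sub_four_of_discr_pos (h2 : finrank ℚ K = 2)
    (hd : 0 < NumberField.discr K) :
    Real.log (((NumberField.discr K).toNat : ℝ) - 4) / Real.sqrt |(NumberField.discr K : ℝ)| ≤
      dedekindZeta_residue K := by
  obtain ⟨hr₁, hr₂⟩ := nrRealPlaces_eq_two_and_nrComplexPlaces_eq_zero h2 hd
  have hw := torsionOrder_eq_two_of_discr_pos h2 hd
  have hR := half_log_sub_four_le_regulator h2 hd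
  have hR0 : 0 < regulator K := regulator_pos K
  have hh : (1 : ℝ) ≤ classNumber K := by exact_mod_cast classNumber_pos K
  have hdR : 0 < Real.sqrt |(NumberField.discr K : ℝ)| :=
    Real.sqrt_pos.2 (abs_pos.2 (by exact_mod_cast NumberField.discr_ne_zero K))
  rw [NumberField.dedekindZeta_residue_def, hr₁, hr₂, hw]
  rw [div_le_div_iff₀ hdR (by positivity)]
  push_cast
  have : regulator K * 1 ≤ regulator K * (classNumber K : ℝ) :=
    mul_le_mul_of_nonneg_left hh hR0.le
  nlinarith

end RegulatorSharp

/-- **Bridge (even real primitive character ↔ real quadratic field):** for an EVEN real primitive `χ`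
mod `D > 1` there is a real quadratic number field `K` with `d_K = D` and `L(1, χ) = κ_K`, the residue of
`ζ_K` at `1` (`D` is a positive fundamental discriminant, `χ` the Kronecker character of `K`,
`ζ_K = ζ · L(χ)`; the steps of `sqrt_mul_norm_LFunction_one_ge_log_of_even`, isolated for reuse).
[cite: NeukirchANT1999, Ch. VII §5 (5.11)] -/
theorem exists_numberField_LFunction_one_eq_of_even {D : ℕ} [NeZero D] (hD : 1 < D)
    {χ : DirichletCharacter ℂ D} (hprim : χ.IsPrimitive) (hquad : χ.IsQuadratic) (heven : χ.Even) :
    ∃ (K : Type) (_ : Field K) (_ : NumberField K),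
      finrank ℚ K = 2 ∧ NumberField.discr K = D ∧
        χ.LFunction 1 = (NumberField.dedekindZeta_residue K : ℂ) := by
  classical
  obtain ⟨K, instF, instNF, h2, hdK⟩ := exists_numberField_discr_eq
    (PrimitiveQuadratic.isFundamentalDiscriminant_of_even hprim hquad heven hD)
  have hD0 : 0 < D := by omega
  -- `χ ≠ 1` (primitive of conductor `D > 1`)
  have hχ1 : χ ≠ 1 := by
    intro h1
    rw [DirichletCharacter.isPrimitive_def, h1, DirichletCharacter.conductor_one] at hprim
    omega
  -- `ζ_K = ζ · L(χ)` on `Re s > 1`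
  have hζ : ∀ s : ℝ, 1 < s →
      NumberField.dedekindZeta K s = riemannZeta s * LSeries (fun n => χ n) s := by
    intro s hs
    refine dedekindZeta_eq_riemannZeta_mul_LSeries_of_kronecker h2 χ ?_ ?_ (by simpa using hs)
    · intro p hp hp2
      haveI := Fact.mk hp
      rw [hdK, PrimitiveQuadratic.apply_prime_eq_legendreSym_of_even hprim hquad heven p hp2,
        jacobiSym.legendreSym.to_jacobiSym]
    · rw [hdK]
      rcases Nat.even_or_odd D with hev | hod
      · have h8a : (D : ℤ) % 8 ≠ 1 := by obtain ⟨k, hk⟩ := hev; omega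
        have h8b : (D : ℤ) % 8 ≠ 5 := by obtain ⟨k, hk⟩ := hev; omega
        rw [if_neg h8a, if_neg h8b, PrimitiveQuadratic.apply_two_of_even hev χ]
      · have hsq := PrimitiveQuadratic.squarefree_of_isPrimitive_of_isQuadratic hod hprim hquad
        have h4 : (D : ℤ) % 4 = 1 := by
          have := PrimitiveQuadratic.mod_four_eq_one_of_even hod hD hprim hquad heven
          omega
        have hval : χ (2 : ZMod D) = (jacobiSym 2 D : ℂ) := by
          have := PrimitiveQuadratic.apply_natCast_eq_jacobiSym hod hsq χ hprim hquad 2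
          rw [Nat.cast_ofNat] at this
          rw [this]; norm_cast
        by_cases h1 : (D : ℤ) % 8 = 1
        · have hJ : jacobiSym 2 D = 1 := by
            have := (jacobiSym_two_natAbs_eq_one_iff h4).mpr h1
            rwa [Int.natAbs_natCast] at this
          rw [if_pos h1, hval, hJ, Int.cast_one]
        · have h5 : (D : ℤ) % 8 = 5 := by omega
          have hJ : jacobiSym 2 D = -1 := by
            have := (jacobiSym_two_natAbs_eq_neg_one_iff h4).mpr h5
            rwa [Int.natAbs_natCast] at this
          rw [if_neg h1, if_pos h5, hval, hJ, Int.cast_neg, Int.cast_one]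
  exact ⟨K, instF, instNF, h2, hdK, LFunction_one_eq_dedekindZeta_residue_of_eq hχ1 hζ⟩

/-- **`√D · L(1, χ) ≥ log(D − 4)` for every EVEN real primitive character `χ` mod `D > 1`** — the class
number formula with `h_K ≥ 1` and the sharp unit floor `R_K ≥ ½ log(D − 4)`; e.g. `≥ 12.899` for
`D > 4·10⁵` (Bordignon 2020 Thm 1.2 prints `12.52` there, BMOR 2018 Lemma 6.3 prints `12`).
[cite: NeukirchANT1999, Ch. VII §5 (5.11)] [cite: JacobsonWilliams2008, §3.3 (ε = (G + B√D)/2 with (3.18))] -/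
theorem sqrt_mul_norm_LFunction_one_ge_log_sub_four_of_even {D : ℕ} [NeZero D] (hD : 1 < D)
    {χ : DirichletCharacter ℂ D} (hprim : χ.IsPrimitive) (hquad : χ.IsQuadratic) (heven : χ.Even) :
    Real.log ((D : ℝ) - 4) ≤ Real.sqrt D * ‖χ.LFunction 1‖ := by
  obtain ⟨K, _, _, h2, hdK, hL⟩ := exists_numberField_LFunction_one_eq_of_even hD hprim hquad heven
  have hD0 : 0 < D := by omega
  have hd : 0 < NumberField.discr K := by rw [hdK]; exact_mod_cast hD0
  have hres := dedekindZeta_residue_ge_log_sub_four_of_discr_pos h2 hd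
  have habs : |(NumberField.discr K : ℝ)| = (D : ℝ) := by
    rw [hdK]; push_cast; exact abs_of_nonneg (Nat.cast_nonneg D)
  have htoNat : ((NumberField.discr K).toNat : ℝ) = D := by
    rw [hdK]; simp
  rw [habs, htoNat] at hres
  have hsqrt : 0 < Real.sqrt D := Real.sqrt_pos.mpr (by exact_mod_cast hD0)
  have hval : ‖χ.LFunction 1‖ = NumberField.dedekindZeta_residue K := by
    rw [hL, Complex.norm_real, Real.norm_eq_abs,
      abs_of_pos (NumberField.dedekindZeta_residue_pos K)]
  rw [hval]
  have := mul_le_mul_of_nonneg_left hres hsqrt.le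
  rwa [mul_div_cancel₀ _ hsqrt.ne'] at this

/-- **Kernel repulsion for EVEN characters, sharp floor: `1 − β ≥ log(q − 4)/(√q (log q)²)`** for every
even primitive quadratic `χ` mod `q ≥ 1600` and every real zero `β` of `L(s, χ)` (as
`one_sub_realZero_ge_log_of_even` with `log(q − 4)` for `log(q/4)`). [cite: MontgomeryVaughan2007, Theorem 11.4 (11.10)]
[cite: NeukirchANT1999, Ch. VII §5 (5.11)] -/
theorem one_sub_realZero_ge_log_sub_four_of_even {q : ℕ} [NeZero q] (hq : 1600 ≤ q)
    {χ : DirichletCharacter ℂ q} (hprim : χ.IsPrimitive) (hquad : χ.IsQuadratic) (heven : χ.Even)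
    {β : ℝ} (hzero : χ.LFunction β = 0) :
    Real.log ((q : ℝ) - 4) / (Real.sqrt q * Real.log q ^ 2) ≤ 1 - β := by
  have hq' : (1600 : ℝ) ≤ q := by exact_mod_cast hq
  have hq0 : (0 : ℝ) < q := by linarith
  have hL7 := seven_lt_log hq
  have hL0 : 0 < Real.log q := by linarith
  have hsq40 : 40 ≤ Real.sqrt q := by
    rw [show (40 : ℝ) = Real.sqrt (40 ^ 2) by rw [Real.sqrt_sq (by norm_num)]]
    exact Real.sqrt_le_sqrt (by norm_num; linarith)
  have hsq : 0 < Real.sqrt q := by linarith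
  have hden : 0 < Real.sqrt q * Real.log q ^ 2 := by positivity
  have hlog4 : Real.log ((q : ℝ) - 4) ≤ Real.log q :=
    Real.log_le_log (by linarith) (by linarith)
  have hlog4pos : 0 < Real.log ((q : ℝ) - 4) := Real.log_pos (by linarith)
  set r : ℝ := 1 / (40 * Real.log q) with hrdef
  by_cases hfar : β < 1 - r
  · -- far zero
    have h1 : Real.log ((q : ℝ) - 4) / (Real.sqrt q * Real.log q ^ 2) ≤ r := by
      rw [hrdef, div_le_div_iff₀ hden (by positivity)]
      have : 40 * Real.log ((q : ℝ) - 4) ≤ Real.sqrt q * Real.log q := by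
        calc 40 * Real.log ((q : ℝ) - 4) ≤ 40 * Real.log q := by nlinarith
          _ ≤ Real.sqrt q * Real.log q := by nlinarith
      nlinarith
    linarith
  · rw [not_lt] at hfar
    have hup := DirichletAbel.norm_LFunction_one_le_log_sq_of_realZero (by omega) hprim hfar hzero
    have hfloor := sqrt_mul_norm_LFunction_one_ge_log_sub_four_of_even (by omega) hprim hquad heven
    have key : Real.log ((q : ℝ) - 4) ≤ Real.sqrt q * ((1 - β) * Real.log q ^ 2) :=
      hfloor.trans (mul_le_mul_of_nonneg_left hup hsq.le)
    rw [div_le_iff₀ hden]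
    nlinarith

end RealZeroRepulsion

end Literature.NumberTheory.LFunctions

end
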